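import Summits.Ventures.HodgeRepro2.T5LevelIdempotent

/-!
# `K`-coinvariants = `K`-invariants through the level idempotent (Tier-5 kernel support, p8)

For a subgroup `K`, Mathlib's `Representation.Coinvariants.ker (restrict ρ K)` is the
augmentation submodule `V(K) = span {ρ κ v − v | κ ∈ K, v ∈ V}` and
`Representation.Coinvariants (restrict ρ K) = V ⧸ V(K)` are the `K`-coinvariants `V_K`.  For
`K`-finite `ρ` in characteristic `0` (smooth `ρ`, compact `K`): the kernel of the level
idempotent `e_K` is exactly `V(K)` (`ker_levelIdempotent`), `V = V^K ⊕ V(K)`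
(`isCompl_invariants_coinvariantsKer`), and `e_K` induces `V_K ≃ V^K` (`coinvariantsEquiv`,
`coinvariantsEquiv_mk`) — the sentence «for a compact open `K` the `K`-coinvariants and the
`K`-invariants coincide», the reason the `K`-invariants functor is exact.  A linear map constant
on `K`-orbits factors through `e_K` (`apply_levelAverage_of_forall_comp_eq`).  Nothing is
asserted about any specific group.
-/

namespace Summit.Ventures.HodgeRepro2.T5LevelCoinvariants

open Summit.Ventures.HodgeRepro2.LevelPositivity Summit.Ventures.HodgeRepro2.T5LevelIdempotent
open Representation (Coinvariants)

variable {G : Type*} [Group G] {k : Type*} [Field k] {V : Type*} [AddCommGroup V] [Module k V]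
  (ρ : Representation k G V) {K : Subgroup G}

/-- The generators `ρ g v − v`, `g ∈ K`, of the augmentation submodule `V(K)`. -/
theorem sub_mem_coinvariantsKer {g : G} (hg : g ∈ K) (v : V) :
    ρ g v - v ∈ Coinvariants.ker (restrict ρ K) :=
  Coinvariants.sub_mem_ker (⟨g, hg⟩ : K) v

/-- `e_K` kills the augmentation submodule (`K`-finite `ρ`, characteristic `0`). -/
theorem coinvariantsKer_le_ker [CharZero k] (hK : KFinite ρ K) :
    Coinvariants.ker (restrict ρ K) ≤ LinearMap.ker (levelIdempotent K hK) := by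
  apply Submodule.span_le.2
  rintro _ ⟨⟨κ, v⟩, rfl⟩
  rw [SetLike.mem_coe, LinearMap.mem_ker, map_sub, levelIdempotent_apply, levelIdempotent_apply]
  haveI := hK v
  exact sub_eq_zero.2 (levelAverage_apply (ρ := ρ) κ)

/-- `v − e_K v` lies in the augmentation submodule. -/
theorem sub_levelAverage_mem_coinvariantsKer [CharZero k] {v : V}
    [(stabilizerIn ρ K v).FiniteIndex] :
    v - levelAverage ρ K v ∈ Coinvariants.ker (restrict ρ K) := by
  letI : Fintype (K ⧸ stabilizerIn ρ K v) := Fintype.ofFinite _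
  have hk : ((stabilizerIn ρ K v).index : k) ≠ 0 :=
    Nat.cast_ne_zero.2 Subgroup.FiniteIndex.index_ne_zero
  have key : v - levelAverage ρ K v = ((stabilizerIn ρ K v).index : k)⁻¹ •
      ∑ c : K ⧸ stabilizerIn ρ K v, (v - ρ ((Quotient.out c : K) : G) v) := by
    rw [Finset.sum_sub_distrib, smul_sub, Finset.sum_const, Finset.card_univ,
      ← Nat.cast_smul_eq_nsmul k, ← Nat.card_eq_fintype_card, ← Subgroup.index_eq_card, smul_smul,
      inv_mul_cancel₀ hk, one_smul]
    unfold levelAverage cosetSum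
    rw [finsum_eq_sum_of_fintype]
  rw [key]
  refine Submodule.smul_mem _ _ (Submodule.sum_mem _ fun c _ => ?_)
  rw [← neg_sub]
  exact Submodule.neg_mem _ (sub_mem_coinvariantsKer ρ (Quotient.out c).2 v)

/-- `ker e_K = V(K)`: the kernel of the level idempotent is the augmentation submodule
(`K`-finite `ρ`, characteristic `0`). -/
theorem ker_levelIdempotent [CharZero k] (hK : KFinite ρ K) :
    LinearMap.ker (levelIdempotent K hK) = Coinvariants.ker (restrict ρ K) := by
  apply le_antisymm
  · intro v hv
    rw [LinearMap.mem_ker, levelIdempotent_apply] at hv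
    haveI := hK v
    have h := sub_levelAverage_mem_coinvariantsKer ρ (K := K) (v := v)
    rwa [hv, sub_zero] at h
  · exact coinvariantsKer_le_ker ρ hK

/-- `V = V^K ⊕ V(K)` (`K`-finite `ρ`, characteristic `0`). -/
theorem isCompl_invariants_coinvariantsKer [CharZero k] (hK : KFinite ρ K) :
    IsCompl (invariants ρ K) (Coinvariants.ker (restrict ρ K)) := by
  rw [← ker_levelIdempotent ρ hK]
  have h := LinearMap.isCompl_of_proj
    (f := (levelIdempotent K hK).codRestrict (invariants ρ K)
      (fun v => by haveI := hK v; exact levelAverage_mem_invariants))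
    (fun x => Subtype.ext (levelAverage_of_mem_invariants x.2))
  rwa [LinearMap.ker_codRestrict] at h

/-- `V^K ⊓ V(K) = 0`. -/
theorem invariants_inf_coinvariantsKer [CharZero k] (hK : KFinite ρ K) :
    invariants ρ K ⊓ Coinvariants.ker (restrict ρ K) = ⊥ :=
  (isCompl_invariants_coinvariantsKer ρ hK).inf_eq_bot

/-- `V^K ⊔ V(K) = V`. -/
theorem invariants_sup_coinvariantsKer [CharZero k] (hK : KFinite ρ K) :
    invariants ρ K ⊔ Coinvariants.ker (restrict ρ K) = ⊤ :=
  (isCompl_invariants_coinvariantsKer ρ hK).sup_eq_top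

/-- The projection onto `V^K` along `V(K)` is the level idempotent. -/
theorem projectionOnto_eq_levelAverage [CharZero k] (hK : KFinite ρ K) (v : V) :
    (invariants ρ K).projectionOnto (Coinvariants.ker (restrict ρ K))
        (isCompl_invariants_coinvariantsKer ρ hK) v =
      ⟨levelAverage ρ K v, by haveI := hK v; exact levelAverage_mem_invariants⟩ := by
  haveI := hK v
  have hdecomp : v = levelAverage ρ K v + (v - levelAverage ρ K v) := by abel
  conv_lhs => rw [hdecomp]
  rw [map_add, Submodule.projectionOnto_apply_of_mem_left _ levelAverage_mem_invariants,
    Submodule.projectionOnto_apply_of_mem_right _ (sub_levelAverage_mem_coinvariantsKer ρ),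
    add_zero]

/-- The `K`-coinvariants are the `K`-invariants: `V_K = V ⧸ V(K) ≃ V^K`
(`K`-finite `ρ`, characteristic `0`). -/
noncomputable def coinvariantsEquiv [CharZero k] (hK : KFinite ρ K) :
    Coinvariants (restrict ρ K) ≃ₗ[k] invariants ρ K :=
  Submodule.quotientEquivOfIsCompl _ _ (isCompl_invariants_coinvariantsKer ρ hK).symm

/-- `coinvariantsEquiv` sends the class of `v` to `e_K v`. -/
theorem coinvariantsEquiv_mk [CharZero k] (hK : KFinite ρ K) (v : V) :
    (coinvariantsEquiv ρ hK (Coinvariants.mk (restrict ρ K) v) : V) = levelAverage ρ K v := by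
  show ((Submodule.quotientEquivOfIsCompl (Coinvariants.ker (restrict ρ K)) (invariants ρ K)
    (isCompl_invariants_coinvariantsKer ρ hK).symm) (Submodule.Quotient.mk v) : V) =
    levelAverage ρ K v
  rw [Submodule.quotientEquivOfIsCompl_apply_mk, projectionOnto_eq_levelAverage ρ hK]

/-- The inverse of `coinvariantsEquiv` is the class of an invariant vector. -/
theorem coinvariantsEquiv_symm_apply [CharZero k] (hK : KFinite ρ K) (x : invariants ρ K) :
    (coinvariantsEquiv ρ hK).symm x = Coinvariants.mk (restrict ρ K) (x : V) :=
  rfl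

/-- A `K`-invariant vector lying in `V(K)` is zero. -/
theorem eq_zero_of_mem_invariants_of_mem_coinvariantsKer [CharZero k] (hK : KFinite ρ K) {v : V}
    (hv : v ∈ invariants ρ K) (hv' : v ∈ Coinvariants.ker (restrict ρ K)) : v = 0 := by
  have h : v ∈ invariants ρ K ⊓ Coinvariants.ker (restrict ρ K) := ⟨hv, hv'⟩
  rwa [invariants_inf_coinvariantsKer ρ hK, Submodule.mem_bot] at h

/-- A linear map constant on `K`-orbits kills `V(K)`. -/
theorem coinvariantsKer_le_ker_of_forall_comp_eq {W : Type*} [AddCommGroup W] [Module k W]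
    (f : V →ₗ[k] W) (hf : ∀ κ : K, f ∘ₗ ρ (κ : G) = f) :
    Coinvariants.ker (restrict ρ K) ≤ LinearMap.ker f := by
  apply Submodule.span_le.2
  rintro _ ⟨⟨κ, v⟩, rfl⟩
  rw [SetLike.mem_coe, LinearMap.mem_ker, map_sub, sub_eq_zero]
  exact congrArg (fun g : V →ₗ[k] W => g v) (hf κ)

/-- A linear map constant on `K`-orbits factors through `e_K`: `f (e_K v) = f v`
(`K`-finite `ρ`, characteristic `0`). -/
theorem apply_levelAverage_of_forall_comp_eq [CharZero k] (hK : KFinite ρ K) {W : Type*}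
    [AddCommGroup W] [Module k W] (f : V →ₗ[k] W) (hf : ∀ κ : K, f ∘ₗ ρ (κ : G) = f) (v : V) :
    f (levelAverage ρ K v) = f v := by
  haveI := hK v
  have h := coinvariantsKer_le_ker_of_forall_comp_eq ρ f hf
    (sub_levelAverage_mem_coinvariantsKer ρ (K := K) (v := v))
  rw [LinearMap.mem_ker, map_sub, sub_eq_zero] at h
  exact h.symm

end Summit.Ventures.HodgeRepro2.T5LevelCoinvariants
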